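import Literature.MathematicalPhysics.QuantumFieldTheory.Federbush1986.LandauModeMultiplierTube
import Literature.MathematicalPhysics.QuantumFieldTheory.Federbush1986.MomentumCellContourShift

/-!
# `Federbush1986.LandauModeMultiplierDecay` — [Federbush1986PhaseCellI] §3 (3.4)/(3.11) p. 327–328: THE LAGRANGE
# (BOND) MULTIPLIERS OF THE LANDAU-GAUGE MODE DECAY EXPONENTIALLY, `|μ_{(m,ν)}| ≤ C e^{−γ Σ_k|m_k|}` — PROVED

statement-level skeleton of published theorems with citation tags; proofs where landed; nothing here is a claim about the Yang–Mills mass gap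

CITATION HEADER.  P. Federbush, *A phase cell approach to Yang–Mills theory. I. Modes, lattice-continuum duality*, Commun.
Math. Phys. **107** (1986) 319–329 [Federbush1986PhaseCellI], §3 p. 327 verbatim: *«We seek a minimum of the action S, for a
Landau gauge A′, a gauge transformation of A. … and then take the limit α → ∞. (Alternatively one could use Lagrange
multipliers.)»*; (3.11) p. 328 `p²A′_ν(p) = Λ_ν(p)·b̂_ν(p)`
(our reading of (3.4) for the corrected Gram matrix, `CorrectedModePlaquetteVariables`), and the decay estimates (3.13)–(3.15)
p. 328 — printed «|A^N_μ(x)| < c e^{−γ|x|}» (3.13), «|DA^N_μ(x)| < c e^{−γ|x|}» (3.14) (v1.3 DOCFIX, referee N-g51-1 of ref-5 gen 51: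
v1–v1.2 wrote here the back-ticked paraphrase `|A(x)| ≤ c e^{−|x|/c}`; declarations untouched) — whose proof is deferred to
P. Federbush, C. Williamson, *II. Analysis of a mode*, J. Math.
Phys. **28** (1987) 1416–1419 [FederbushWilliamson1987PhaseCellII], §III–§IV p. 1417 verbatim: *«We take the analytic extensions of the
expressions in Sec. II from real p to complex p.»*, *«Equations (3.13)–(3.15) of Ref. 1 follow directly from Theorems 3.2 and 3.3 of the
last section by standard techniques.»* (v1.2 DOCFIX, r17 gen 13 quotation audit, declarations untouched: the v1/v1.1 parenthetical «(shifting
the domain of integration in (2.4) into a complex domain …)» inside the quotation marks was a paraphrase, not print).  This module applies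
the standard technique (contour shift) to the MULTIPLIERS: unit `lit-balaban-r17` gen 12;
SKELETON rows F1.Eq3.2-3.12 and F1.Eq3.1 of `run/shared/lean/pub/lit-balaban/lit-balaban-r17/SKELETON-r17.md`.

THE MATHEMATICS.  The bond multiplier of the Euler–Lagrange identity of `LandauModeBondMultipliers`
(`integral_crossDensity_field_eq_sum_bondMult`: `∫ Σ_{μ<ν} F_{μν}(A^N)F_{μν}(ψ) = Σ_{(m,ν)} μ_{(m,ν)} ψ(m,ν)` for every
smooth compactly supported `ψ`) is the cell Fourier coefficient `μ_{(m,ν)} = Re (1/2π)² ∫_{[0,2π]⁴} Λ_ν(p) e^{ip·m} d⁴p`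
(`bondMult`).  By `LandauModeMultiplierTube.exists_LamT_analytic_bounded` the periodic function `Λ_ν` agrees off the lattice
hyperplanes (a null set, `integral_cell_Lam_eq_LamT`) with `Λ̃_ν = N_ν/((1/2π)²D_ν)`, complex-differentiable and bounded by
`C` on the box-tube `{|Re z_j| < 9, |Im z_j| < κ₁}`, `2πℤ⁴`-periodic; by the periodic contour shift on the cell
(`MomentumCellContourShift.norm_setIntegral_cell_mul_cexp_le`, shift by `i(κ₁/2)sgn(m_j)e_j`)
`|μ_{(m,ν)}| ≤ (1/2π)²(2π)⁴ C e^{−(κ₁/2)|m_j|}` for every `j` (**`exists_bondMult_le_exp`**), hence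
`≤ C′e^{−γΣ_k|m_k|}` with `γ = κ₁/8` (**`exists_bondMult_le_exp_sum`**, the largest `|m_j|` carries a quarter of the ℓ¹ norm),
uniformly in `ν` (**`exists_bondMult_le_exp_sum_all`**).  This is the decay needed to pass from compactly supported test
fields to a general finite-action competitor in the constrained minimality of `A^N` (the hypothesis `hmin` of
`CorrectedMode.modeEstimatesLe_of_field_minimal`).

WHAT THIS MODULE PROVIDES.  The three theorems above and `integral_cell_Lam_eq_LamT`.  No definition, no `Prop` fact, no
`sorry`; axioms standard.
v1.1 (r17 gen 13; DOCFIX, declarations untouched): the v1 header quoted as «§3 p. 327 verbatim» a sentence («Equation (3.1) is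
realized inductively proceeding upwards in r, the conditions imposed with Lagrange multipliers.») that is on no page of
[Federbush1986PhaseCellI] (pp. 319–329 read; cf. referee asks ref-1 g60 / ref-5 g46 on the sibling files); it was a paraphrase and is
replaced by the printed (3.4) sentence of p. 327.
-/

namespace Literature.MathematicalPhysics.QuantumFieldTheory.Federbush1986

noncomputable section

open Complex ModeAnalyticity Filter Topology MeasureTheory Set
open scoped BigOperators ComplexConjugate

namespace CorrectedMode

open PlaquetteGram
open ModeDecay (toC shiftI)

/-- The cell integral defining `μ_{(m,ν)}` may be taken with the analytic representative `Λ̃_ν` in place of `Λ_ν` (they agree off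
the null set of lattice hyperplanes). [cite: Federbush1986PhaseCellI, (3.11) p. 328; FederbushWilliamson1987PhaseCellII, (3.1) p. 1417] -/
theorem integral_cell_Lam_eq_LamT (s : ℕ) (ν : Fin 4) (m : Fin 4 → ℤ) :
    ∫ p in cell, Lam ν (toC p) * cexp (I * ∑ k, (p k : ℂ) * (m k : ℂ))
      = ∫ p in cell, LamT s ν (toC p) * cexp (I * ∑ k, (p k : ℂ) * (m k : ℂ)) := by
  refine setIntegral_congr_ae measurableSet_cell' ?_
  filter_upwards [ae_off_lattice] with p hp _
  rw [LamT_toC s ν hp]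

/-- **THE BOND MULTIPLIERS DECAY EXPONENTIALLY (per direction `ν`)**: there are `C ≥ 0` and `γ > 0` with
`|μ_{(m,ν)}| ≤ C e^{−γ|m_j|}` for every `m ∈ ℤ⁴` and every coordinate `j` — the periodic contour shift of
`(1/2π)² ∫_cell Λ̃_ν(p) e^{ip·m} d⁴p` by `iγ sgn(m_j) e_j` inside the tube where `Λ̃_ν` is analytic and bounded.
[cite: Federbush1986PhaseCellI, (3.11) p. 328, (3.13) p. 328; FederbushWilliamson1987PhaseCellII, §III–§IV p. 1417] -/
theorem exists_bondMult_le_exp (ν : Fin 4) : ∃ C γ : ℝ, 0 ≤ C ∧ 0 < γ ∧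
    ∀ (m : Fin 4 → ℤ) (j : Fin 4), |bondMult ν m| ≤ C * Real.exp (-(γ * |(m j : ℝ)|)) := by
  obtain ⟨κ₁, C, hκ₁, -, hC0, hdiff, hbound, -⟩ := exists_LamT_analytic_bounded 0 ν
  have hk : 0 ≤ kR := by unfold kR; positivity
  have h2π : 2 * Real.pi < 9 := by linarith [Real.pi_lt_d2]
  refine ⟨kR * ((2 * Real.pi) ^ 4 * C), κ₁ / 2, by positivity, by positivity, fun m j => ?_⟩
  have hper : ∀ z (n : Fin 4 → ℤ), LamT 0 ν (shift z n) = LamT 0 ν z := fun z n => LamT_shift 0 ν z n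
  have hmain := norm_setIntegral_cell_mul_cexp_le (H := LamT 0 ν) (R := 9) (κ := κ₁) h2π hκ₁ hdiff hbound hper m j
    (t := κ₁ / 2) (by positivity) (by linarith)
  rw [bondMult, integral_cell_Lam_eq_LamT 0 ν m]
  refine (Complex.abs_re_le_norm _).trans ?_
  rw [norm_mul, Complex.norm_real, Real.norm_of_nonneg hk]
  calc kR * ‖∫ p in cell, LamT 0 ν (toC p) * cexp (I * ∑ k, (p k : ℂ) * (m k : ℂ))‖
      ≤ kR * ((2 * Real.pi) ^ 4 * C * Real.exp (-(κ₁ / 2 * |(m j : ℝ)|))) := mul_le_mul_of_nonneg_left hmain hk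
    _ = _ := by ring

/-- **Isotropic form**: `|μ_{(m,ν)}| ≤ C e^{−γ Σ_k |m_k|}` (with `γ/4` of the directional rate). [cite: Federbush1986PhaseCellI, (3.13) p. 328] -/
theorem exists_bondMult_le_exp_sum (ν : Fin 4) : ∃ C γ : ℝ, 0 ≤ C ∧ 0 < γ ∧
    ∀ m : Fin 4 → ℤ, |bondMult ν m| ≤ C * Real.exp (-(γ * ∑ k, |(m k : ℝ)|)) := by
  obtain ⟨C, γ, hC, hγ, h⟩ := exists_bondMult_le_exp ν
  refine ⟨C, γ / 4, hC, by positivity, fun m => ?_⟩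
  obtain ⟨j, -, hj⟩ := Finset.exists_max_image Finset.univ (fun k => |(m k : ℝ)|) Finset.univ_nonempty
  refine (h m j).trans (mul_le_mul_of_nonneg_left (Real.exp_le_exp.mpr ?_) hC)
  have : ∑ k, |(m k : ℝ)| ≤ 4 * |(m j : ℝ)| := by
    calc ∑ k, |(m k : ℝ)| ≤ ∑ _k : Fin 4, |(m j : ℝ)| := Finset.sum_le_sum fun k _ => hj k (Finset.mem_univ k)
      _ = 4 * |(m j : ℝ)| := by simp
  nlinarith

/-- **Uniform constants over the four directions.** [cite: Federbush1986PhaseCellI, (3.11), (3.13) p. 328] -/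
theorem exists_bondMult_le_exp_sum_all : ∃ C γ : ℝ, 0 ≤ C ∧ 0 < γ ∧
    ∀ (ν : Fin 4) (m : Fin 4 → ℤ), |bondMult ν m| ≤ C * Real.exp (-(γ * ∑ k, |(m k : ℝ)|)) := by
  choose C γ hC hγ h using exists_bondMult_le_exp_sum
  refine ⟨∑ ν, C ν, Finset.univ.inf' Finset.univ_nonempty γ, Finset.sum_nonneg fun ν _ => hC ν,
    (Finset.lt_inf'_iff _).2 fun ν _ => hγ ν, fun ν m => ?_⟩
  have hCle : C ν ≤ ∑ μ, C μ := Finset.single_le_sum (fun μ _ => hC μ) (Finset.mem_univ ν)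
  have hγle : Finset.univ.inf' Finset.univ_nonempty γ ≤ γ ν := Finset.inf'_le _ (Finset.mem_univ ν)
  have hS : 0 ≤ ∑ k, |(m k : ℝ)| := Finset.sum_nonneg fun k _ => abs_nonneg _
  refine (h ν m).trans ?_
  exact mul_le_mul hCle (Real.exp_le_exp.mpr (by nlinarith)) (Real.exp_pos _).le (Finset.sum_nonneg fun ν _ => hC ν)

end CorrectedMode

end

end Literature.MathematicalPhysics.QuantumFieldTheory.Federbush1986
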